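import Literature.Topology.FourManifolds.ThetaFour
import Literature.Topology.FourManifolds.HCobordismDonaldson
import Literature.Topology.FourManifolds.SphereSimplyConnected
import Literature.AlgebraicTopology.SingularHomology.UniversalCoefficientsProofs
import Literature.AlgebraicTopology.SingularHomology.ExcisionMayerVietorisProofs
import Literature.AlgebraicTopology.SingularHomology.SimplyConnectedH1
import HarnessLib

/-!
# `Θ₄ = 0` along Wall's route: every homotopy 4-sphere is h-cobordant to `S⁴`, GIVEN Wall's Thm. 2

Topic `Literature/Topology/FourManifolds`; a second first-layer reduction of the named fact
`Literature.Topology.FourManifolds.isHCobordant_sphere_of_homotopySphere_four` (`ThetaFour.lean`: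
`Θ₄ = 0` in Kervaire–Milnor's h-cobordism sense), complementary to the Kervaire–Milnor
decomposition of `ThetaFourKervaireMilnor.lean` (four leaves: Lemma 2.3, Thm. 3.1, §4 with
`Π₄ = 0`, Thm. 5.1). Here the single leaf is **Wall 1964, Thm. 2** — C. T. C. Wall, *On
simply-connected 4-manifolds*, J. London Math. Soc. 39 (1964), p. 141: "Two simply-connected closed
4-manifolds with isomorphic quadratic forms are h-cobordant" — as vendored in the tree
(`Literature.Topology.FourManifolds.isHCobordant_of_equivalent_intersectionForm`,
`HCobordismDonaldson.lean`, over the tree's intersection form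
`Literature.AlgebraicTopology.SingularHomology.intersectionForm` on `H²(·; ℤ)/T`). This is the
route printed by Freedman–Kitaev–Nayak–Slingerland–Walker–Wang, *Universal manifold pairings and
positivity*, Geom. Topol. 9 (2005), proof of Thm. 4.1 (§4): "It is well known that smooth
homotopy equivalent 4-manifolds `P` and `Q` are smoothly h-cobordant" — for simply connected `P`,
`Q` this is Wall's Thm. 2 combined with the homotopy invariance of the intersection form.

## What is proved (sorry-free; everything except Wall's Thm. 2 is a theorem of the tree)

* `bilinForm_equivalent_of_subsingleton`: two bilinear forms on trivial modules are equivalent.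
* `subsingleton_freeCohomology_two_of_homotopyEquiv_sphere_four`: **`H²(X; ℤ)/T = 0` for every
  space `X` homotopy equivalent to `S⁴`.** Proof over the tree's singular (co)homology:
  `H₂(X; ℤ) ≅ H₂(S⁴; ℤ) = 0` (homotopy invariance `singularHomology.isoOfHomotopyEquiv`, proved;
  `isZero_singularHomology_sphere_holds`, Hatcher Cor. 2.14, proved), `H₁(X; ℤ) = 0` (`X` is simply
  connected, `isZero_singularHomology_one_of_simplyConnectedSpace`, proved), so the Kronecker map
  `h : H²(X; ℤ) → Hom(H₂(X; ℤ), ℤ) = 0` vanishes and, by the PROVED half of the universal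
  coefficient theorem `ker h ⊆ T` (`ker_kroneckerPairing_le_torsion`, Hatcher Thm. 3.2 with
  p. 196), every class of `H²(X; ℤ)` is torsion. (No Poincaré duality and no `Ext` is used.)
* `HomotopySphere.equivalent_intersectionForm_sphere_four`: the intersection forms of a homotopy
  4-sphere and of `S⁴` (for any `ℤ`-orientations) are isometric — both live on the zero module.
* `isHCobordant_sphere_of_homotopySphere_four_of_wallThmTwo`: **`Θ₄ = 0` GIVEN Wall's Thm. 2**:
  a homotopy 4-sphere `Σ` and `S⁴` are simply connected (`π₁(S⁴) = 1`,
  `simplyConnectedSpace_sphere_four_holds`, transported along `Σ ≃ₕ S⁴`), hence `ℤ`-orientable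
  (`isOrientableOver_of_simplyConnectedSpace`, Hatcher Prop. 3.25, proved), with isometric (zero)
  intersection forms, so Wall's Thm. 2 yields `IsHCobordant 4 Σ S⁴`.

So relative to the tree, `Θ₄ = 0` — and with it every statement the tree derives from it
(`HomotopyS4SmoothCase.lean`, `WallStabilisation.lean`, the barrier entries
`HCobordismInvariantsBlind.lean`, `StableInvariantsBlind.lean`) — now rests on ONE printed
theorem, Wall's Thm. 2, as an alternative to the four Kervaire–Milnor leaves. Wall's Thm. 2 itself
(oriented cobordism, surgery and diffeomorphisms of 4-dimensional handlebody boundaries, Wall 1964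
§2) is a theory absent from Mathlib and from the tree; nothing is discharged unconditionally and no
definition or statement of the tree is touched.

## References

* C. T. C. Wall, *On simply-connected 4-manifolds*, J. London Math. Soc. 39 (1964) 141–149,
  Thm. 2 (p. 141; proof §2, p. 144). [WallJLMS1964]
* M. Kervaire, J. Milnor, *Groups of homotopy spheres I*, Ann. of Math. 77 (1963), table
  p. 504 (`Θ₄ = 0`; Thm. 1.1 is the group structure). [KervaireMilnorAnnals1963]
* M. Freedman, A. Kitaev, C. Nayak, J. Slingerland, K. Walker, Z. Wang, *Universal manifold
  pairings and positivity*, Geom. Topol. 9 (2005) 2303–2317, proof of Thm. 4.1. [FKNSWW2005]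
* A. Hatcher, *Algebraic Topology* (2002), Cor. 2.11, Cor. 2.14, Thm. 3.2 and p. 196, Prop. 3.25.
  [HatcherAT2002]
* J. Milnor, D. Husemoller, *Symmetric bilinear forms* (1973), §V.1. [MilnorHusemoller1973]
-/

noncomputable section

open scoped Manifold ContDiff
open CategoryTheory CategoryTheory.Limits
open Literature.AlgebraicTopology.SingularHomology

namespace Literature.Topology.FourManifolds

/-! ### Bilinear forms on the zero module -/

/-- **Any two bilinear forms on trivial modules are equivalent** (`LinearMap.BilinForm.Equivalent`):
the unique linear equivalence `0 ≃ 0` transforms `B₁` into `B₂`, both being identically zero.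
[folklore] -/
theorem bilinForm_equivalent_of_subsingleton {R M₁ M₂ : Type*} [CommRing R] [AddCommGroup M₁]
    [Module R M₁] [AddCommGroup M₂] [Module R M₂] [Subsingleton M₁] [Subsingleton M₂]
    (B₁ : LinearMap.BilinForm R M₁) (B₂ : LinearMap.BilinForm R M₂) : B₁.Equivalent B₂ :=
  ⟨{ toFun := 0
     invFun := 0
     map_add' := fun x y => by simp
     map_smul' := fun r x => by simp
     left_inv := fun x => Subsingleton.elim _ _
     right_inv := fun x => Subsingleton.elim _ _
     map_app' := fun x y => by
       rw [Subsingleton.elim x 0]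
       simp }⟩

/-! ### `H²(Σ; ℤ)/T = 0` for a homotopy 4-sphere -/

/-- **Every class of `H²(X; ℤ)` is torsion when `H₂(X; ℤ) = 0` and `H₁(X; ℤ)` is finitely
generated**: the Kronecker map `h : H²(X; ℤ) → Hom(H₂(X; ℤ), ℤ)` is then zero, and `ker h` consists
of torsion classes by the proved half of the universal coefficient theorem
(`ker_kroneckerPairing_le_torsion`; Hatcher 2002, Thm. 3.2 with p. 196).
[cite: HatcherAT2002, §3.1 Thm. 3.2 (p. 195) and p. 196] -/
theorem mem_torsion_singularCohomology_two_of_isZero {X : Type} [TopologicalSpace X]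
    [Module.Finite ℤ (singularHomology ℤ ℤ X 1)] (h2 : IsZero (singularHomology ℤ ℤ X 2))
    (a : singularCohomology ℤ ℤ X 2) :
    a ∈ Submodule.torsion ℤ ↥(singularCohomology ℤ ℤ X 2) := by
  refine ker_kroneckerPairing_le_torsion ℤ X 1 (LinearMap.mem_ker.mpr ?_)
  haveI : Subsingleton (singularHomology ℤ ℤ X 2) := ModuleCat.subsingleton_of_isZero h2
  ext c
  rw [Subsingleton.elim c 0, map_zero, map_zero]

/-- **`H²(X; ℤ)/T = 0` for every space homotopy equivalent to `S⁴`.** `H₂(X; ℤ) ≅ H₂(S⁴; ℤ) = 0`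
(Hatcher 2002, Cor. 2.11 and Cor. 2.14; tree theorems `singularHomology.isoOfHomotopyEquiv`,
`isZero_singularHomology_sphere_holds`), `X` is simply connected (`π₁(S⁴) = 1`, Hatcher Prop. 1.14,
`simplyConnectedSpace_sphere_four_holds`) so `H₁(X; ℤ) = 0`
(`isZero_singularHomology_one_of_simplyConnectedSpace`), and then every class of `H²(X; ℤ)` is
torsion (`mem_torsion_singularCohomology_two_of_isZero`), i.e. dies in
`freeCohomology ℤ X 2 = H²(X; ℤ)/T`. [cite: HatcherAT2002, Cor. 2.11, Cor. 2.14, Thm. 3.2 with p. 196] -/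
theorem subsingleton_freeCohomology_two_of_homotopyEquiv_sphere_four (X : Type) [TopologicalSpace X]
    (e : ContinuousMap.HomotopyEquiv X (Metric.sphere (0 : EuclideanSpace ℝ (Fin 5)) 1)) : Subsingleton (freeCohomology ℤ X 2) := by
  haveI : SimplyConnectedSpace (Metric.sphere (0 : EuclideanSpace ℝ (Fin 5)) 1) := simplyConnectedSpace_sphere_four_holds
  haveI : SimplyConnectedSpace X := e.simplyConnectedSpace
  have h2 : IsZero (singularHomology ℤ ℤ X 2) :=
    (isZero_singularHomology_sphere_holds ℤ ℤ (n := 4) (k := 2) two_ne_zero (by decide)).of_iso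
      (singularHomology.isoOfHomotopyEquiv ℤ ℤ e 2)
  have h1 : IsZero (singularHomology ℤ ℤ X 1) :=
    isZero_singularHomology_one_of_simplyConnectedSpace ℤ ℤ
  haveI : Subsingleton (singularHomology ℤ ℤ X 1) := ModuleCat.subsingleton_of_isZero h1
  haveI : Module.Finite ℤ (singularHomology ℤ ℤ X 1) := Module.Finite.of_finite
  refine ⟨fun x y => ?_⟩
  obtain ⟨a, rfl⟩ := freeCohomology.mk_surjective x
  obtain ⟨b, rfl⟩ := freeCohomology.mk_surjective y
  rw [(freeCohomology.mk_eq_zero_iff a).mpr (mem_torsion_singularCohomology_two_of_isZero h2 a),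
    (freeCohomology.mk_eq_zero_iff b).mpr (mem_torsion_singularCohomology_two_of_isZero h2 b)]

/-- **`H²(S⁴; ℤ)/T = 0`.** [cite: HatcherAT2002, Cor. 2.14 and Thm. 3.2] -/
theorem subsingleton_freeCohomology_two_sphere_four : Subsingleton (freeCohomology ℤ (Metric.sphere (0 : EuclideanSpace ℝ (Fin 5)) 1) 2) :=
  subsingleton_freeCohomology_two_of_homotopyEquiv_sphere_four (Metric.sphere (0 : EuclideanSpace ℝ (Fin 5)) 1)
    (ContinuousMap.HomotopyEquiv.refl _)

namespace HomotopySphere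

/-- **`H²(Σ; ℤ)/T = 0` for a homotopy 4-sphere `Σ`** (its carrier is homotopy equivalent to `S⁴`).
[cite: HatcherAT2002, Cor. 2.11, Cor. 2.14 and Thm. 3.2] -/
theorem subsingleton_freeCohomology_two (S : HomotopySphere 4) :
    Subsingleton (freeCohomology ℤ S.carrier 2) := by
  obtain ⟨e⟩ := S.nonempty_homotopyEquiv
  exact subsingleton_freeCohomology_two_of_homotopyEquiv_sphere_four S.carrier e

/-- **The intersection form of a homotopy 4-sphere is that of `S⁴`**: for all `ℤ`-orientations
`μ` of `Σ` and `ν` of `S⁴`, `Q_{(Σ, μ)} ≅ Q_{(S⁴, ν)}`, both being the zero form on the zero module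
`H²/T = 0` (Milnor–Husemoller 1973, §V.1; this is the instance of "homotopy equivalent simply
connected 4-manifolds have isomorphic forms" needed for `Θ₄`). [cite: MilnorHusemoller1973, §V.1] -/
theorem equivalent_intersectionForm_sphere_four (S : HomotopySphere 4)
    (μ : HomologicalOrientation ℤ S.carrier 4) (ν : HomologicalOrientation ℤ (Metric.sphere (0 : EuclideanSpace ℝ (Fin 5)) 1) 4) :
    (intersectionForm two_add_two_eq_four μ).Equivalent (intersectionForm two_add_two_eq_four ν) := by
  haveI := S.subsingleton_freeCohomology_two
  haveI := subsingleton_freeCohomology_two_sphere_four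
  exact bilinForm_equivalent_of_subsingleton _ _

end HomotopySphere

/-! ### `Θ₄ = 0` from Wall's Thm. 2 -/

/-- **A homotopy 4-sphere is h-cobordant to `S⁴`, GIVEN Wall's Thm. 2** (one homotopy sphere).
`Σ` and `S⁴` are closed smooth simply connected 4-manifolds (`π₁(S⁴) = 1` transported along
`Σ ≃ₕ S⁴`), hence `ℤ`-orientable (`isOrientableOver_of_simplyConnectedSpace`, Hatcher Prop. 3.25),
and their intersection forms are isometric (`HomotopySphere.equivalent_intersectionForm_sphere_four`);
Wall 1964, Thm. 2 ("Two simply-connected closed 4-manifolds with isomorphic quadratic forms are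
h-cobordant"; tree fact `isHCobordant_of_equivalent_intersectionForm`, hypothesis `hW`) gives the
h-cobordism. [cite: WallJLMS1964, Thm. 2 (p. 141, proof §2 p. 144)] [cite: HatcherAT2002, Prop. 3.25] -/
theorem HomotopySphere.isHCobordant_sphere_four_of_wallThmTwo
    (hW : isHCobordant_of_equivalent_intersectionForm) (S : HomotopySphere 4) :
    Literature.Topology.FourManifolds.IsHCobordant 4 S.carrier (Metric.sphere (0 : EuclideanSpace ℝ (Fin 5)) 1) := by
  haveI : SimplyConnectedSpace (Metric.sphere (0 : EuclideanSpace ℝ (Fin 5)) 1) := simplyConnectedSpace_sphere_four_holds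
  obtain ⟨e⟩ := S.nonempty_homotopyEquiv
  haveI : SimplyConnectedSpace S.carrier := e.simplyConnectedSpace
  obtain ⟨μ⟩ := isOrientableOver_of_simplyConnectedSpace ℤ S.carrier (n := 4)
  obtain ⟨ν⟩ := isOrientableOver_of_simplyConnectedSpace ℤ (Metric.sphere (0 : EuclideanSpace ℝ (Fin 5)) 1) (n := 4)
  exact hW S.carrier (Metric.sphere (0 : EuclideanSpace ℝ (Fin 5)) 1) μ ν (S.equivalent_intersectionForm_sphere_four μ ν)

/-- **`Θ₄ = 0` (h-cobordism form) GIVEN Wall's Thm. 2.** Every homotopy 4-sphere is smoothly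
h-cobordant to `S⁴` — the tree's named fact `isHCobordant_sphere_of_homotopySphere_four`
(Kervaire–Milnor 1963, table p. 504: `Θ₄ = 0`) — follows from Wall 1964, Thm. 2 alone
(`isHCobordant_of_equivalent_intersectionForm`), the forms of `Σ` and `S⁴` both being zero. This is
the sentence "It is well known that smooth homotopy equivalent 4-manifolds `P` and `Q` are smoothly
h-cobordant" of Freedman–Kitaev–Nayak–Slingerland–Walker–Wang 2005, proof of Thm. 4.1, in the case
`P = Σ`, `Q = S⁴`. An alternative to the Kervaire–Milnor leaf set of
`isHCobordant_sphere_of_homotopySphere_four_of_leaves` (`ThetaFourKervaireMilnor.lean`).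
[cite: WallJLMS1964, Thm. 2 (p. 141)] [cite: KervaireMilnorAnnals1963, table p. 504 (Θ₄ = 0)] [cite: FKNSWW2005, proof of Thm. 4.1] -/
theorem isHCobordant_sphere_of_homotopySphere_four_of_wallThmTwo
    (hW : isHCobordant_of_equivalent_intersectionForm) :
    isHCobordant_sphere_of_homotopySphere_four :=
  fun S => S.isHCobordant_sphere_four_of_wallThmTwo hW

end Literature.Topology.FourManifolds

end
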